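/-
Copyright (c) 2026. All rights reserved.
Released under Apache 2.0 license as described in the file LICENSE.
Authors: abc-iut cell, prover seat abc-iut-f-072 (gen 11).
-/
import Mathlib.NumberTheory.NumberField.Discriminant.Basic
import Mathlib.Analysis.Real.Pi.Bounds
import HarnessLib

/-!
# Minkowski's discriminant bound as DEGREE THRESHOLDS: `12^n < d_K²` for `n ≥ 7`, `24^n < d_K²` for `n ≥ 31`

Classical geometry of numbers (nothing disputed; no definition, no `Prop` fact, no instance).  Mathlib's
`NumberField.abs_discr_ge'` is the SHARP convex-body bound
`n^{2n} / ((4/π)^{2 r₂} · (n!)²) ≤ |d_K|` (`n = [K:ℚ]`, `r₂` = number of complex places) — Minkowski's bound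
(Esmonde–Murty, *Problems in Algebraic Number Theory*, Ex. 6.5.12, and its consequence Ex. 6.5.21:
`|d_K| ≥ (π/4)^n (n^n/n!)²`).  Mathlib only packages the weak numerical corollary `abs_discr_ge`
(`(4/9)(3π/4)^n ≤ |d_K|`, root discriminant `→ 3π/4 ≈ 2.36`).  THIS FILE extracts from the sharp bound the two
ROOT-DISCRIMINANT THRESHOLDS `2√3 ≈ 3.46` and `2√6 ≈ 4.90` in exact integer currency:

* §1 elementary real inequalities: the four-term binomial bound `one_add_pow_ge_four_terms`,
  `(1 + 1/n)^n ≥ 5/2` for `n ≥ 6` (`five_halves_le_one_add_inv_pow`), hence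
  `(625/16)·n^{4n} ≤ (n+1)^{4n}` (`pow_four_mul_le_succ_pow_four_mul`);
* §2 the two numerical engines by induction on `n` (`Real.pi_gt_d2 : 3.14 < π` for the base cases and the step):
  `192^n · (n!)^4 < π^{2n} · n^{4n}` for `n ≥ 8` and `384^n · (n!)^4 < π^{2n} · n^{4n}` for `n ≥ 32`;
* §3 **`twelve_pow_lt_discr_sq`**: `7 ≤ [K:ℚ] ⇒ 12^{[K:ℚ]} < d_K²` (i.e. `rd_K > 2√3`; the case `n = 7` uses the
  integrality `2 r₂ ≤ 6`), **`twentyfour_pow_lt_discr_sq`**: `31 ≤ [K:ℚ] ⇒ 24^{[K:ℚ]} < d_K²` (`rd_K > 2√6`; `n = 31`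
  via `2 r₂ ≤ 30`), and the integer corollaries `twelve_pow_half_lt_abs_discr` (`12^{⌊n/2⌋} < |d_K|`),
  `two_pow_mul_three_pow_half_lt_abs_discr` (`2^n · 3^{⌊n/2⌋} < |d_K|`), `twentyfour_pow_half_lt_abs_discr`
  (`24^{⌊n/2⌋} < |d_K|`);
* §3b the small odd degrees: `12 < |d_K|` for cubics, `12² < |d_K|` for quintics, hence
  **`twelve_pow_half_lt_abs_discr_of_ne`**: `12^{⌊n/2⌋} < |d_K|` for every degree `n ≥ 3`, `n ≠ 4, 6`.

The thresholds are the EXACT ones the sharp bound gives: for `n = 6` (resp. `n = 30`) and `r₂ = 3` (resp. `15`) the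
Minkowski lower bound is `≈ 986 < 12³ = 1728` (resp. `≈ 0.72 · 24^{15}`), so no smaller degree threshold follows from
`abs_discr_ge'` alone.  Consumer: the abc-iut cell's branch E, R-J row Y-26 (E ROWS #1 R-23): a number field all of
whose ramified places are quadratic with residue degree `1` over `2` and `3` has `|d_K| ≤ 24^{⌊n/2⌋}` by the
Dedekind–Hensel different bound (resp. `≤ 12^{⌊n/2⌋}` with the exact dyadic different exponent `2`), so such fields
have degree `≤ 30` (resp. `≤ 6`).  Nothing here is specific to that consumer.
[cite: EsmondeMurty1999, Ex. 6.5.12 and Ex. 6.5.21 p. 93]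
-/

namespace Literature.NumberTheory.NumberFields

open NumberField NumberField.InfinitePlace Module Real

/-! ## §1. Elementary real inequalities -/

/-- The four-term binomial lower bound `1 + n x + n(n−1)/2 · x² + n(n−1)(n−2)/6 · x³ ≤ (1 + x)^n` for `x ≥ 0`
(all further binomial terms are non-negative). [cite: EsmondeMurty1999, Ex. 6.5.21 p. 93] -/
theorem one_add_pow_ge_four_terms {x : ℝ} (hx : 0 ≤ x) (n : ℕ) :
    1 + n * x + n * (n - 1) / 2 * x ^ 2 + n * (n - 1) * (n - 2) / 6 * x ^ 3 ≤ (1 + x) ^ n := by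
  induction n with
  | zero => simp
  | succ k ih =>
    have h1 : 0 ≤ 1 + x := by linarith
    have hk3 : (0 : ℝ) ≤ k * (k - 1) * (k - 2) := by
      rcases Nat.lt_or_ge k 3 with hlt | hge
      · interval_cases k <;> norm_num
      · have h3 : (3 : ℝ) ≤ k := by exact_mod_cast hge
        have h1' : (0 : ℝ) ≤ k - 1 := by linarith
        have h2' : (0 : ℝ) ≤ k - 2 := by linarith
        positivity
    have hid : (1 + k * x + k * (k - 1) / 2 * x ^ 2 + k * (k - 1) * (k - 2) / 6 * x ^ 3) * (1 + x)
        = (1 + ((k + 1 : ℕ) : ℝ) * x + ((k + 1 : ℕ) : ℝ) * (((k + 1 : ℕ) : ℝ) - 1) / 2 * x ^ 2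
          + ((k + 1 : ℕ) : ℝ) * (((k + 1 : ℕ) : ℝ) - 1) * (((k + 1 : ℕ) : ℝ) - 2) / 6 * x ^ 3)
          + k * (k - 1) * (k - 2) / 6 * x ^ 4 := by
      push_cast; ring
    have hx4 : 0 ≤ k * (k - 1) * (k - 2) / 6 * x ^ 4 := by positivity
    calc (1 : ℝ) + ((k + 1 : ℕ) : ℝ) * x + ((k + 1 : ℕ) : ℝ) * (((k + 1 : ℕ) : ℝ) - 1) / 2 * x ^ 2
          + ((k + 1 : ℕ) : ℝ) * (((k + 1 : ℕ) : ℝ) - 1) * (((k + 1 : ℕ) : ℝ) - 2) / 6 * x ^ 3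
        ≤ (1 + k * x + k * (k - 1) / 2 * x ^ 2 + k * (k - 1) * (k - 2) / 6 * x ^ 3) * (1 + x) := by
          rw [hid]; linarith
      _ ≤ (1 + x) ^ k * (1 + x) := mul_le_mul_of_nonneg_right ih h1
      _ = (1 + x) ^ (k + 1) := (pow_succ _ _).symm

/-- `(1 + 1/n)^n ≥ 5/2` for every `n ≥ 6` (four binomial terms: `2 + (n−1)/(2n) + (n−1)(n−2)/(6n²) ≥ 5/2 ⟺
n² − 6n + 2 ≥ 0`). [cite: EsmondeMurty1999, Ex. 6.5.21 p. 93] -/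
theorem five_halves_le_one_add_inv_pow {n : ℕ} (hn : 6 ≤ n) :
    (5 / 2 : ℝ) ≤ (1 + 1 / (n : ℝ)) ^ n := by
  have hn' : (6 : ℝ) ≤ n := by exact_mod_cast hn
  have hn0 : (0 : ℝ) < n := by linarith
  have h := one_add_pow_ge_four_terms (x := 1 / (n : ℝ)) (by positivity) n
  have hcalc : (1 : ℝ) + n * (1 / n) + n * (n - 1) / 2 * (1 / n) ^ 2 + n * (n - 1) * (n - 2) / 6 * (1 / n) ^ 3
      = 2 + (n - 1) / (2 * n) + (n - 1) * (n - 2) / (6 * n ^ 2) := by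
    field_simp
    ring
  rw [hcalc] at h
  have hkey : (5 / 2 : ℝ) ≤ 2 + (n - 1) / (2 * n) + (n - 1) * (n - 2) / (6 * n ^ 2) := by
    have hid : (2 : ℝ) + (n - 1) / (2 * n) + (n - 1) * (n - 2) / (6 * n ^ 2) - 5 / 2
        = ((n : ℝ) ^ 2 - 6 * n + 2) / (6 * n ^ 2) := by
      field_simp
      ring
    have hnn : 0 ≤ ((n : ℝ) ^ 2 - 6 * n + 2) / (6 * n ^ 2) := div_nonneg (by nlinarith) (by positivity)
    linarith
  exact hkey.trans h

/-- `(625/16) · n^{4n} ≤ (n+1)^{4n}` for `n ≥ 6` (`(n+1)^n = n^n (1 + 1/n)^n ≥ (5/2)·n^n`, fourth powers).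
[cite: EsmondeMurty1999, Ex. 6.5.21 p. 93] -/
theorem pow_four_mul_le_succ_pow_four_mul {n : ℕ} (hn : 6 ≤ n) :
    (625 / 16 : ℝ) * (n : ℝ) ^ (4 * n) ≤ ((n : ℝ) + 1) ^ (4 * n) := by
  have hn0 : (0 : ℝ) < n := by exact_mod_cast (show 0 < n by omega)
  have h52 := five_halves_le_one_add_inv_pow hn
  have hsucc : ((n : ℝ) + 1) ^ n = (n : ℝ) ^ n * (1 + 1 / (n : ℝ)) ^ n := by
    rw [← mul_pow]; congr 1; field_simp
  have hle : (5 / 2 : ℝ) * (n : ℝ) ^ n ≤ ((n : ℝ) + 1) ^ n := by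
    rw [hsucc, mul_comm]
    exact mul_le_mul_of_nonneg_left h52 (by positivity)
  have h0 : (0 : ℝ) ≤ (5 / 2 : ℝ) * (n : ℝ) ^ n := by positivity
  calc (625 / 16 : ℝ) * (n : ℝ) ^ (4 * n) = ((5 / 2 : ℝ) * (n : ℝ) ^ n) ^ 4 := by
        rw [mul_pow, ← pow_mul, mul_comm n 4]; norm_num
    _ ≤ (((n : ℝ) + 1) ^ n) ^ 4 := pow_le_pow_left₀ h0 hle 4
    _ = ((n : ℝ) + 1) ^ (4 * n) := by rw [← pow_mul, mul_comm n 4]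

/-! ## §2. The two numerical engines -/

/-- The induction step shared by both engines: if `c ≤ (625/16)·π²` then `c · n^{4n} ≤ π² · (n+1)^{4n}` for `n ≥ 6`.
[cite: EsmondeMurty1999, Ex. 6.5.21 p. 93] -/
theorem mul_pow_le_pi_sq_mul_succ_pow {c : ℝ} (hc : c ≤ 625 / 16 * π ^ 2) {n : ℕ} (hn : 6 ≤ n) :
    c * (n : ℝ) ^ (4 * n) ≤ π ^ 2 * ((n : ℝ) + 1) ^ (4 * n) := by
  have h := pow_four_mul_le_succ_pow_four_mul hn
  have hpi : (0 : ℝ) ≤ π ^ 2 := by positivity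
  calc c * (n : ℝ) ^ (4 * n) ≤ 625 / 16 * π ^ 2 * (n : ℝ) ^ (4 * n) :=
        mul_le_mul_of_nonneg_right hc (by positivity)
    _ = π ^ 2 * (625 / 16 * (n : ℝ) ^ (4 * n)) := by ring
    _ ≤ π ^ 2 * ((n : ℝ) + 1) ^ (4 * n) := mul_le_mul_of_nonneg_left h hpi

/-- **Engine for the `2√3` threshold**: `192^n · (n!)^4 < π^{2n} · n^{4n}` for every `n ≥ 8`
(base `n = 8` from `π > 3.14`; step by `mul_pow_le_pi_sq_mul_succ_pow`, `192 ≤ (625/16)·9`).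
[cite: EsmondeMurty1999, Ex. 6.5.21 p. 93] -/
theorem engine_twelve {n : ℕ} (hn : 8 ≤ n) :
    (192 : ℝ) ^ n * ((n.factorial : ℕ) : ℝ) ^ 4 < π ^ (2 * n) * (n : ℝ) ^ (4 * n) := by
  induction n, hn using Nat.le_induction with
  | base =>
    have hpi := Real.pi_gt_d2
    have h16 : (3.14 : ℝ) ^ (2 * 8) < π ^ (2 * 8) := pow_lt_pow_left₀ hpi (by norm_num) (by norm_num)
    have hnum : (192 : ℝ) ^ 8 * ((Nat.factorial 8 : ℕ) : ℝ) ^ 4 < (3.14 : ℝ) ^ (2 * 8) * ((8 : ℕ) : ℝ) ^ (4 * 8) := by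
      norm_num [Nat.factorial]
    exact hnum.trans (mul_lt_mul_of_pos_right h16 (by positivity))
  | succ k hk ih =>
    have hk6 : 6 ≤ k := by omega
    have hc : (192 : ℝ) ≤ 625 / 16 * π ^ 2 := by nlinarith [Real.pi_gt_three, Real.pi_pos]
    have hstep := mul_pow_le_pi_sq_mul_succ_pow hc hk6
    have hk0 : (0 : ℝ) < (k : ℝ) + 1 := by positivity
    rw [Nat.factorial_succ, Nat.cast_mul, mul_pow, pow_succ]
    push_cast
    calc (192 : ℝ) ^ k * 192 * (((k : ℝ) + 1) ^ 4 * ((k.factorial : ℕ) : ℝ) ^ 4)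
        = 192 * ((k : ℝ) + 1) ^ 4 * ((192 : ℝ) ^ k * ((k.factorial : ℕ) : ℝ) ^ 4) := by ring
      _ < 192 * ((k : ℝ) + 1) ^ 4 * (π ^ (2 * k) * (k : ℝ) ^ (4 * k)) :=
          mul_lt_mul_of_pos_left ih (by positivity)
      _ = ((k : ℝ) + 1) ^ 4 * π ^ (2 * k) * (192 * (k : ℝ) ^ (4 * k)) := by ring
      _ ≤ ((k : ℝ) + 1) ^ 4 * π ^ (2 * k) * (π ^ 2 * ((k : ℝ) + 1) ^ (4 * k)) :=
          mul_le_mul_of_nonneg_left hstep (by positivity)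
      _ = π ^ (2 * (k + 1)) * ((k : ℝ) + 1) ^ (4 * (k + 1)) := by ring

/-- **Engine for the `2√6` threshold**: `384^n · (n!)^4 < π^{2n} · n^{4n}` for every `n ≥ 32`
(base `n = 32` from `π > 3.14`; step by `mul_pow_le_pi_sq_mul_succ_pow`, `384 ≤ (625/16)·3.14²`).
[cite: EsmondeMurty1999, Ex. 6.5.21 p. 93] -/
theorem engine_twentyfour {n : ℕ} (hn : 32 ≤ n) :
    (384 : ℝ) ^ n * ((n.factorial : ℕ) : ℝ) ^ 4 < π ^ (2 * n) * (n : ℝ) ^ (4 * n) := by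
  induction n, hn using Nat.le_induction with
  | base =>
    have hpi := Real.pi_gt_d2
    have h64 : (3.14 : ℝ) ^ (2 * 32) < π ^ (2 * 32) := pow_lt_pow_left₀ hpi (by norm_num) (by norm_num)
    have hnum : (384 : ℝ) ^ 32 * ((Nat.factorial 32 : ℕ) : ℝ) ^ 4
        < (3.14 : ℝ) ^ (2 * 32) * ((32 : ℕ) : ℝ) ^ (4 * 32) := by
      norm_num [Nat.factorial]
    exact hnum.trans (mul_lt_mul_of_pos_right h64 (by positivity))
  | succ k hk ih =>
    have hk6 : 6 ≤ k := by omega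
    have hc : (384 : ℝ) ≤ 625 / 16 * π ^ 2 := by nlinarith [Real.pi_gt_d2, Real.pi_pos]
    have hstep := mul_pow_le_pi_sq_mul_succ_pow hc hk6
    have hk0 : (0 : ℝ) < (k : ℝ) + 1 := by positivity
    rw [Nat.factorial_succ, Nat.cast_mul, mul_pow, pow_succ]
    push_cast
    calc (384 : ℝ) ^ k * 384 * (((k : ℝ) + 1) ^ 4 * ((k.factorial : ℕ) : ℝ) ^ 4)
        = 384 * ((k : ℝ) + 1) ^ 4 * ((384 : ℝ) ^ k * ((k.factorial : ℕ) : ℝ) ^ 4) := by ring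
      _ < 384 * ((k : ℝ) + 1) ^ 4 * (π ^ (2 * k) * (k : ℝ) ^ (4 * k)) :=
          mul_lt_mul_of_pos_left ih (by positivity)
      _ = ((k : ℝ) + 1) ^ 4 * π ^ (2 * k) * (384 * (k : ℝ) ^ (4 * k)) := by ring
      _ ≤ ((k : ℝ) + 1) ^ 4 * π ^ (2 * k) * (π ^ 2 * ((k : ℝ) + 1) ^ (4 * k)) :=
          mul_le_mul_of_nonneg_left hstep (by positivity)
      _ = π ^ (2 * (k + 1)) * ((k : ℝ) + 1) ^ (4 * (k + 1)) := by ring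

/-! ## §3. The degree thresholds for number fields -/

section NumberField

variable (K : Type*) [Field K] [NumberField K]

/-- Minkowski's bound with the complex places estimated away: `n^{2n} · π^a ≤ |d_K| · 4^a · (n!)²` for every
`a ≥ 2 r₂` (Mathlib `NumberField.abs_discr_ge'` and `1 ≤ 4/π`). [cite: EsmondeMurty1999, Ex. 6.5.12 and Ex. 6.5.21 p. 93] -/
theorem pow_mul_pi_pow_le_abs_discr_mul {a : ℕ} (ha : 2 * nrComplexPlaces K ≤ a) :
    ((finrank ℚ K : ℕ) : ℝ) ^ (2 * finrank ℚ K) * π ^ a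
      ≤ |((discr K : ℤ) : ℝ)| * 4 ^ a * ((finrank ℚ K).factorial : ℝ) ^ 2 := by
  have hM := NumberField.abs_discr_ge' K
  rw [Int.cast_abs] at hM
  have hpos : (0 : ℝ) < (4 / π) ^ (2 * nrComplexPlaces K) * ((finrank ℚ K).factorial : ℝ) ^ 2 := by positivity
  rw [div_le_iff₀ hpos] at hM
  have h1 : (1 : ℝ) ≤ 4 / π := by
    rw [le_div_iff₀ Real.pi_pos, one_mul]; exact Real.pi_lt_four.le
  have hmono : (4 / π : ℝ) ^ (2 * nrComplexPlaces K) ≤ (4 / π) ^ a := pow_le_pow_right₀ h1 ha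
  have h2 : ((finrank ℚ K : ℕ) : ℝ) ^ (2 * finrank ℚ K)
      ≤ |((discr K : ℤ) : ℝ)| * ((4 / π) ^ a * ((finrank ℚ K).factorial : ℝ) ^ 2) :=
    hM.trans (mul_le_mul_of_nonneg_left (mul_le_mul_of_nonneg_right hmono (by positivity)) (abs_nonneg _))
  have h3 := mul_le_mul_of_nonneg_right h2 (pow_nonneg Real.pi_pos.le a)
  have hid : |((discr K : ℤ) : ℝ)| * ((4 / π) ^ a * ((finrank ℚ K).factorial : ℝ) ^ 2) * π ^ a
      = |((discr K : ℤ) : ℝ)| * 4 ^ a * ((finrank ℚ K).factorial : ℝ) ^ 2 := by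
    rw [div_pow]
    field_simp
  rw [hid] at h3
  exact h3

/-- The squaring step: a numerical inequality `b^n · 16^a · (n!)^4 < n^{4n} · π^{2a}` with `a ≥ 2 r₂` gives `b^n < d_K²`.
[cite: EsmondeMurty1999, Ex. 6.5.21 p. 93] -/
theorem pow_lt_discr_sq_of_numeric {b : ℝ} {a : ℕ} (ha : 2 * nrComplexPlaces K ≤ a)
    (hnum : b ^ finrank ℚ K * 16 ^ a * ((finrank ℚ K).factorial : ℝ) ^ 4
      < ((finrank ℚ K : ℕ) : ℝ) ^ (4 * finrank ℚ K) * π ^ (2 * a)) :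
    b ^ finrank ℚ K < ((discr K : ℤ) : ℝ) ^ 2 := by
  have hM := pow_mul_pi_pow_le_abs_discr_mul K ha
  have hA : (0 : ℝ) ≤ ((finrank ℚ K : ℕ) : ℝ) ^ (2 * finrank ℚ K) * π ^ a := by positivity
  have hsq := pow_le_pow_left₀ hA hM 2
  have hl : (((finrank ℚ K : ℕ) : ℝ) ^ (2 * finrank ℚ K) * π ^ a) ^ 2
      = ((finrank ℚ K : ℕ) : ℝ) ^ (4 * finrank ℚ K) * π ^ (2 * a) := by
    rw [mul_pow, ← pow_mul, ← pow_mul]; ring_nf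
  have hr : (|((discr K : ℤ) : ℝ)| * 4 ^ a * ((finrank ℚ K).factorial : ℝ) ^ 2) ^ 2
      = ((discr K : ℤ) : ℝ) ^ 2 * (16 ^ a * ((finrank ℚ K).factorial : ℝ) ^ 4) := by
    rw [mul_pow, mul_pow, sq_abs, ← pow_mul, ← pow_mul]
    rw [show (4 : ℝ) ^ (a * 2) = 16 ^ a by rw [mul_comm, pow_mul]; norm_num]
    ring
  rw [hl, hr] at hsq
  have hpos : (0 : ℝ) < 16 ^ a * ((finrank ℚ K).factorial : ℝ) ^ 4 := by positivity
  have hlt : b ^ finrank ℚ K * (16 ^ a * ((finrank ℚ K).factorial : ℝ) ^ 4)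
      < ((discr K : ℤ) : ℝ) ^ 2 * (16 ^ a * ((finrank ℚ K).factorial : ℝ) ^ 4) := by
    calc b ^ finrank ℚ K * (16 ^ a * ((finrank ℚ K).factorial : ℝ) ^ 4)
        = b ^ finrank ℚ K * 16 ^ a * ((finrank ℚ K).factorial : ℝ) ^ 4 := by ring
      _ < ((finrank ℚ K : ℕ) : ℝ) ^ (4 * finrank ℚ K) * π ^ (2 * a) := hnum
      _ ≤ _ := hsq
  exact lt_of_mul_lt_mul_right hlt hpos.le

/-- **`12^{[K:ℚ]} < d_K²` for every number field of degree `[K:ℚ] ≥ 7`** — root discriminant `> 2√3`.  Degrees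
`≥ 8`: `engine_twelve` with `a = n ≥ 2 r₂`; degree `7`: `2 r₂ ≤ 6` and `12^7 · 16^6 · (7!)^4 < 7^{28} · 3.14^{12}`.
[cite: EsmondeMurty1999, Ex. 6.5.12 and Ex. 6.5.21 p. 93] -/
theorem twelve_pow_lt_discr_sq (h7 : 7 ≤ finrank ℚ K) : (12 : ℤ) ^ finrank ℚ K < discr K ^ 2 := by
  have hsig := NumberField.InfinitePlace.card_add_two_mul_card_eq_rank K
  suffices h : (12 : ℝ) ^ finrank ℚ K < ((discr K : ℤ) : ℝ) ^ 2 by exact_mod_cast h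
  rcases (show finrank ℚ K = 7 ∨ 8 ≤ finrank ℚ K by omega) with h7' | h8
  · have ha : 2 * nrComplexPlaces K ≤ 6 := by omega
    refine pow_lt_discr_sq_of_numeric K ha ?_
    rw [h7']
    have hpi := Real.pi_gt_d2
    have h12 : (3.14 : ℝ) ^ (2 * 6) < π ^ (2 * 6) := pow_lt_pow_left₀ hpi (by norm_num) (by norm_num)
    have hnum : (12 : ℝ) ^ 7 * 16 ^ 6 * ((Nat.factorial 7 : ℕ) : ℝ) ^ 4
        < ((7 : ℕ) : ℝ) ^ (4 * 7) * (3.14 : ℝ) ^ (2 * 6) := by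
      norm_num [Nat.factorial]
    exact hnum.trans (mul_lt_mul_of_pos_left h12 (by positivity))
  · have ha : 2 * nrComplexPlaces K ≤ finrank ℚ K := by omega
    refine pow_lt_discr_sq_of_numeric K ha ?_
    have h := engine_twelve h8
    calc (12 : ℝ) ^ finrank ℚ K * 16 ^ finrank ℚ K * ((finrank ℚ K).factorial : ℝ) ^ 4
        = 192 ^ finrank ℚ K * ((finrank ℚ K).factorial : ℝ) ^ 4 := by
          rw [← mul_pow]; norm_num
      _ < π ^ (2 * finrank ℚ K) * ((finrank ℚ K : ℕ) : ℝ) ^ (4 * finrank ℚ K) := h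
      _ = ((finrank ℚ K : ℕ) : ℝ) ^ (4 * finrank ℚ K) * π ^ (2 * finrank ℚ K) := mul_comm _ _

/-- **`24^{[K:ℚ]} < d_K²` for every number field of degree `[K:ℚ] ≥ 31`** — root discriminant `> 2√6`.  Degrees
`≥ 32`: `engine_twentyfour`; degree `31`: `2 r₂ ≤ 30` and `24^{31} · 16^{30} · (31!)^4 < 31^{124} · 3.14^{60}`.
[cite: EsmondeMurty1999, Ex. 6.5.12 and Ex. 6.5.21 p. 93] -/
theorem twentyfour_pow_lt_discr_sq (h31 : 31 ≤ finrank ℚ K) : (24 : ℤ) ^ finrank ℚ K < discr K ^ 2 := by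
  have hsig := NumberField.InfinitePlace.card_add_two_mul_card_eq_rank K
  suffices h : (24 : ℝ) ^ finrank ℚ K < ((discr K : ℤ) : ℝ) ^ 2 by exact_mod_cast h
  rcases (show finrank ℚ K = 31 ∨ 32 ≤ finrank ℚ K by omega) with h31' | h32
  · have ha : 2 * nrComplexPlaces K ≤ 30 := by omega
    refine pow_lt_discr_sq_of_numeric K ha ?_
    rw [h31']
    have hpi := Real.pi_gt_d2
    have h60 : (3.14 : ℝ) ^ (2 * 30) < π ^ (2 * 30) := pow_lt_pow_left₀ hpi (by norm_num) (by norm_num)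
    have hnum : (24 : ℝ) ^ 31 * 16 ^ 30 * ((Nat.factorial 31 : ℕ) : ℝ) ^ 4
        < ((31 : ℕ) : ℝ) ^ (4 * 31) * (3.14 : ℝ) ^ (2 * 30) := by
      norm_num [Nat.factorial]
    exact hnum.trans (mul_lt_mul_of_pos_left h60 (by positivity))
  · have ha : 2 * nrComplexPlaces K ≤ finrank ℚ K := by omega
    refine pow_lt_discr_sq_of_numeric K ha ?_
    have h := engine_twentyfour h32
    calc (24 : ℝ) ^ finrank ℚ K * 16 ^ finrank ℚ K * ((finrank ℚ K).factorial : ℝ) ^ 4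
        = 384 ^ finrank ℚ K * ((finrank ℚ K).factorial : ℝ) ^ 4 := by
          rw [← mul_pow]; norm_num
      _ < π ^ (2 * finrank ℚ K) * ((finrank ℚ K : ℕ) : ℝ) ^ (4 * finrank ℚ K) := h
      _ = ((finrank ℚ K : ℕ) : ℝ) ^ (4 * finrank ℚ K) * π ^ (2 * finrank ℚ K) := mul_comm _ _

/-- From `b² < d_K²` style bounds to `|d_K|`: if `c² ≤ b^n < d_K²` then `c < |d_K|`. [cite: EsmondeMurty1999, Ex. 6.5.21 p. 93] -/
theorem lt_abs_discr_of_sq_le {c m : ℤ} (hcm : c ^ 2 ≤ m) (hm : m < discr K ^ 2) :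
    c < |discr K| := by
  have h : c ^ 2 < |discr K| ^ 2 := by rw [sq_abs]; exact hcm.trans_lt hm
  exact lt_of_pow_lt_pow_left₀ 2 (abs_nonneg _) h

/-- **`12^{⌊n/2⌋} < |d_K|`** for `[K:ℚ] = n ≥ 7`. [cite: EsmondeMurty1999, Ex. 6.5.21 p. 93] -/
theorem twelve_pow_half_lt_abs_discr (h7 : 7 ≤ finrank ℚ K) :
    (12 : ℤ) ^ (finrank ℚ K / 2) < |discr K| := by
  refine lt_abs_discr_of_sq_le K ?_ (twelve_pow_lt_discr_sq K h7)
  rw [← pow_mul]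
  exact pow_le_pow_right₀ (by norm_num) (by omega)

/-- **`2^n · 3^{⌊n/2⌋} < |d_K|`** for `[K:ℚ] = n ≥ 7` (the sharper odd-degree form: `(2^n 3^{⌊n/2⌋})² ≤ 12^n`).
[cite: EsmondeMurty1999, Ex. 6.5.21 p. 93] -/
theorem two_pow_mul_three_pow_half_lt_abs_discr (h7 : 7 ≤ finrank ℚ K) :
    (2 : ℤ) ^ finrank ℚ K * 3 ^ (finrank ℚ K / 2) < |discr K| := by
  refine lt_abs_discr_of_sq_le K ?_ (twelve_pow_lt_discr_sq K h7)
  have h3 : (3 : ℤ) ^ (finrank ℚ K / 2 * 2) ≤ 3 ^ finrank ℚ K :=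
    pow_le_pow_right₀ (by norm_num) (by omega)
  calc ((2 : ℤ) ^ finrank ℚ K * 3 ^ (finrank ℚ K / 2)) ^ 2
      = 4 ^ finrank ℚ K * 3 ^ (finrank ℚ K / 2 * 2) := by
        rw [mul_pow, ← pow_mul, ← pow_mul, mul_comm (finrank ℚ K) 2, pow_mul]; norm_num
    _ ≤ 4 ^ finrank ℚ K * 3 ^ finrank ℚ K := mul_le_mul_of_nonneg_left h3 (by positivity)
    _ = 12 ^ finrank ℚ K := by rw [← mul_pow]; norm_num

/-- **`24^{⌊n/2⌋} < |d_K|`** for `[K:ℚ] = n ≥ 31`. [cite: EsmondeMurty1999, Ex. 6.5.21 p. 93] -/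
theorem twentyfour_pow_half_lt_abs_discr (h31 : 31 ≤ finrank ℚ K) :
    (24 : ℤ) ^ (finrank ℚ K / 2) < |discr K| := by
  refine lt_abs_discr_of_sq_le K ?_ (twentyfour_pow_lt_discr_sq K h31)
  rw [← pow_mul]
  exact pow_le_pow_right₀ (by norm_num) (by omega)

/-- **`8^{⌊n/2⌋} · 3^{⌊n/2⌋} < |d_K|`** for `[K:ℚ] = n ≥ 31` — the form consumed by the local-discriminant count
(`≤ ⌊n/2⌋` ramified places over `2` with different exponent `≤ 3`, `≤ ⌊n/2⌋` over `3` with exponent `≤ 1`).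
[cite: EsmondeMurty1999, Ex. 6.5.21 p. 93] -/
theorem eight_pow_half_mul_three_pow_half_lt_abs_discr (h31 : 31 ≤ finrank ℚ K) :
    (8 : ℤ) ^ (finrank ℚ K / 2) * 3 ^ (finrank ℚ K / 2) < |discr K| := by
  rw [← mul_pow]; exact twentyfour_pow_half_lt_abs_discr K h31

/-- **`4^{⌊n/2⌋} · 3^{⌊n/2⌋} < |d_K|`** for `[K:ℚ] = n ≥ 7` — the form consumed by the sharp local count (dyadic
different exponent `2`). [cite: EsmondeMurty1999, Ex. 6.5.21 p. 93] -/
theorem four_pow_half_mul_three_pow_half_lt_abs_discr (h7 : 7 ≤ finrank ℚ K) :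
    (4 : ℤ) ^ (finrank ℚ K / 2) * 3 ^ (finrank ℚ K / 2) < |discr K| := by
  rw [← mul_pow]; exact twelve_pow_half_lt_abs_discr K h7

/-! ### §3b. The small odd degrees `3` and `5`

For `n = 3, 5` the currency `12^{⌊n/2⌋}` only asks for `12 < |d_K|`, resp. `12² < |d_K|`, which the sharp bound gives
(`|d_K| > 12.4` for cubics, `> 257` for quintics), whereas `n = 4` (`r₂ = 2`: bound `≈ 43 < 144`) and `n = 6`
(`r₂ = 3`: `≈ 986 < 1728`) genuinely fail: `12^{⌊n/2⌋} < |d_K|` holds in EVERY degree `n ≥ 3` except `n ∈ {4, 6}`. -/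

/-- Variant of `pow_lt_discr_sq_of_numeric` with a real constant `m ≥ 0` in place of `b^n` (take `b = m^{1/n}`).
[cite: EsmondeMurty1999, Ex. 6.5.21 p. 93] -/
theorem lt_discr_sq_of_numeric {m : ℝ} (hm : 0 ≤ m) {a : ℕ} (ha : 2 * nrComplexPlaces K ≤ a)
    (hnum : m * 16 ^ a * ((finrank ℚ K).factorial : ℝ) ^ 4
      < ((finrank ℚ K : ℕ) : ℝ) ^ (4 * finrank ℚ K) * π ^ (2 * a)) :
    m < ((discr K : ℤ) : ℝ) ^ 2 := by
  have hb : (m ^ ((finrank ℚ K : ℝ)⁻¹)) ^ finrank ℚ K = m :=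
    Real.rpow_inv_natCast_pow hm Module.finrank_pos.ne'
  have h := pow_lt_discr_sq_of_numeric K (b := m ^ ((finrank ℚ K : ℝ)⁻¹)) ha (by rwa [hb])
  rwa [hb] at h

/-- **`12 < |d_K|` for every cubic number field** (`2 r₂ ≤ 2` and `144 · 16² · (3!)^4 = 47 775 744 < 3^{12} · 3.14^4`).
[cite: EsmondeMurty1999, Ex. 6.5.12 and Ex. 6.5.21 p. 93] -/
theorem twelve_lt_abs_discr_of_finrank_eq_three (h3 : finrank ℚ K = 3) : (12 : ℤ) < |discr K| := by
  have hsig := NumberField.InfinitePlace.card_add_two_mul_card_eq_rank K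
  refine lt_abs_discr_of_sq_le K (m := 144) (by norm_num) ?_
  suffices h : (144 : ℝ) < ((discr K : ℤ) : ℝ) ^ 2 by exact_mod_cast h
  refine lt_discr_sq_of_numeric K (by norm_num) (show 2 * nrComplexPlaces K ≤ 2 by omega) ?_
  rw [h3]
  have h4 : (3.14 : ℝ) ^ (2 * 2) < π ^ (2 * 2) := pow_lt_pow_left₀ Real.pi_gt_d2 (by norm_num) (by norm_num)
  have hnum : (144 : ℝ) * 16 ^ 2 * ((Nat.factorial 3 : ℕ) : ℝ) ^ 4
      < ((3 : ℕ) : ℝ) ^ (4 * 3) * (3.14 : ℝ) ^ (2 * 2) := by norm_num [Nat.factorial]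
  exact hnum.trans (mul_lt_mul_of_pos_left h4 (by positivity))

/-- **`12² < |d_K|` for every quintic number field** (`2 r₂ ≤ 4` and `12⁴ · 16⁴ · (5!)^4 ≈ 2.818 · 10^{17} <
5^{20} · 3.14^8 ≈ 9.012 · 10^{17}`). [cite: EsmondeMurty1999, Ex. 6.5.12 and Ex. 6.5.21 p. 93] -/
theorem sq_twelve_lt_abs_discr_of_finrank_eq_five (h5 : finrank ℚ K = 5) : (144 : ℤ) < |discr K| := by
  have hsig := NumberField.InfinitePlace.card_add_two_mul_card_eq_rank K
  refine lt_abs_discr_of_sq_le K (m := 20736) (by norm_num) ?_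
  suffices h : (20736 : ℝ) < ((discr K : ℤ) : ℝ) ^ 2 by exact_mod_cast h
  refine lt_discr_sq_of_numeric K (by norm_num) (show 2 * nrComplexPlaces K ≤ 4 by omega) ?_
  rw [h5]
  have h8 : (3.14 : ℝ) ^ (2 * 4) < π ^ (2 * 4) := pow_lt_pow_left₀ Real.pi_gt_d2 (by norm_num) (by norm_num)
  have hnum : (20736 : ℝ) * 16 ^ 4 * ((Nat.factorial 5 : ℕ) : ℝ) ^ 4
      < ((5 : ℕ) : ℝ) ^ (4 * 5) * (3.14 : ℝ) ^ (2 * 4) := by norm_num [Nat.factorial]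
  exact hnum.trans (mul_lt_mul_of_pos_left h8 (by positivity))

/-- **`12^{⌊n/2⌋} < |d_K|` for every number field of degree `n ≥ 3`, `n ≠ 4, 6`** — the cubic and quintic cases
joined to `twelve_pow_half_lt_abs_discr` (`n ≥ 7`); the excluded degrees are exactly those where the sharp bound is
below `12^{n/2}`. [cite: EsmondeMurty1999, Ex. 6.5.12 and Ex. 6.5.21 p. 93] -/
theorem twelve_pow_half_lt_abs_discr_of_ne (h3 : 3 ≤ finrank ℚ K) (h4 : finrank ℚ K ≠ 4)
    (h6 : finrank ℚ K ≠ 6) : (12 : ℤ) ^ (finrank ℚ K / 2) < |discr K| := by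
  rcases (show finrank ℚ K = 3 ∨ finrank ℚ K = 5 ∨ 7 ≤ finrank ℚ K by omega) with h | h | h
  · rw [h]; exact twelve_lt_abs_discr_of_finrank_eq_three K h
  · rw [h]; exact sq_twelve_lt_abs_discr_of_finrank_eq_five K h
  · exact twelve_pow_half_lt_abs_discr K h

/-- Contrapositive in the consumer's shape: degree `n ≥ 3` and `|d_K| ≤ 12^{⌊n/2⌋}` force `n = 4` or `n = 6`.
[cite: EsmondeMurty1999, Ex. 6.5.21 p. 93] -/
theorem finrank_eq_four_or_six_of_abs_discr_le (h3 : 3 ≤ finrank ℚ K)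
    (hd : |discr K| ≤ (12 : ℤ) ^ (finrank ℚ K / 2)) : finrank ℚ K = 4 ∨ finrank ℚ K = 6 := by
  by_contra h
  exact absurd hd (not_le.mpr
    (twelve_pow_half_lt_abs_discr_of_ne K h3 (fun h4 => h (Or.inl h4)) (fun h6 => h (Or.inr h6))))

end NumberField

end Literature.NumberTheory.NumberFields
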